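import Mathlib
import HarnessLib
import Summits.Ventures.LatticeQCDFlow.Exactness.BoxMuller
import Summits.Ventures.LatticeQCDFlow.Exactness.MarsagliaTsangGamma
import Summits.Ventures.LatticeQCDFlow.Exactness.VMFSiteHeatBathGeneral

/-!
# From the uniform stream: the Gaussian vector, the Beta primitive and the CP(N−1) site heat bath, composed

HONEST FRAMING: exact (Metropolis-corrected) sampling algorithms for lattice gauge theory;
figures of merit are autocorrelation/cost numbers at stated couplings and volumes; no
continuum-physics claim.

Venture `LatticeQCDFlow` (cell pub-lqcd), topic `Exactness`, FANOUT row 9 (eng-latcore, the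
engine `latflow.core`).  NEW WORK of the cell: COMPOSITION COROLLARIES of row 9's gen-11/12 files
(`BoxMuller`, `MarsagliaTsangGamma`, `BetaFromGammas`, `WoodSampler`, `VMFSiteHeatBathGeneral`) with
Mathlib's `Measure.pi_map_pi` / `map_pi_eq_stdGaussian`.  Nothing is cited as a fact.

The per-stage theorems say each primitive is exact given the previous one; this file writes the
stages together so that the only inputs left are INDEPENDENT UNIFORMS (and, for the gamma loop, the
standard Gaussian it consumes — itself `map_boxMuller_cos` / `map_polarOut_fst` of uniforms):

* **`stdGaussian_eq_map_boxMuller_pi`** — a standard Gaussian vector of `ℝ^ι` IS `ι` independent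
  Box–Muller variates: `stdGaussian (EuclideanSpace ℝ ι) = (⊗ᵢ (unitLaw ⊗ unitLaw)).map (u ↦ (√(−2 log uᵢ₁) cos 2πuᵢ₂)ᵢ)`;
* **`betaMeasure_eq_map_mtLoops`** — Wood's Beta primitive IS the ratio of two independent
  Marsaglia–Tsang loops: `betaMeasure a a = ((loopLaw (mtRound d)) ⊗ (loopLaw (mtRound d))).map (x/(x+y))`,
  `a = d + 1/3`, `d ≥ 7/6`; `betaMeasure_cpn_eq_map_mtLoops` — the engine's instance `a = N − 1/2`,
  `d = N − 5/6` for every `N ≥ 2`;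
* **`map_siteHB_boxMuller`** — THE CP(N−1) SITE HEAT BATH FROM WOOD'S COSINE AND `2N` BOX–MULLER PAIRS
  OF UNIFORMS is EXACTLY the normalised von Mises–Fisher law with mean direction `m`, for every `m`.

NOT CLAIMED: a single probability space carrying the whole engine stream (the loops `loopLaw` are
composed as laws, not as stopping times on one sequence); floating point.
-/

namespace Summit.Ventures.LatticeQCDFlow.Exactness

open MeasureTheory Measure Metric Set Real ProbabilityTheory WithLp
open scoped ENNReal

/-! ## §1 The Gaussian vector from Box–Muller pairs -/

/-- The single Box–Muller variate `√(−2 log u₁) cos(2π u₂)`. -/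
noncomputable def bmVariate (p : ℝ × ℝ) : ℝ := Real.sqrt (-2 * Real.log p.1) * Real.cos (2 * π * p.2)

/-- `bmVariate` is measurable. -/
theorem measurable_bmVariate : Measurable bmVariate := measurable_fst.comp measurable_boxMuller

/-- `bmVariate` of two independent uniforms is `N(0,1)` (`BoxMuller.map_boxMuller_cos`). -/
theorem map_bmVariate : (unitLaw.prod unitLaw).map bmVariate = gaussianReal 0 1 := map_boxMuller_cos

/-- **A standard Gaussian vector is a vector of independent Box–Muller variates**: for a finite index
type `ι`, `stdGaussian (ℝ^ι)` is the image of `ι` independent pairs of uniforms. -/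
theorem stdGaussian_eq_map_boxMuller_pi (ι : Type*) [Fintype ι] :
    stdGaussian (EuclideanSpace ℝ ι) =
      ((Measure.pi fun _ : ι => unitLaw.prod unitLaw).map
        fun u => toLp 2 fun i => bmVariate (u i)) := by
  haveI : ∀ _i : ι, IsProbabilityMeasure ((unitLaw.prod unitLaw).map bmVariate) :=
    fun _ => isProbabilityMeasure_map measurable_bmVariate.aemeasurable
  have hm : Measurable fun u : ι → ℝ × ℝ => fun i => bmVariate (u i) :=
    measurable_pi_lambda _ fun i => measurable_bmVariate.comp (measurable_pi_apply i)
  rw [show (fun u : ι → ℝ × ℝ => toLp 2 fun i => bmVariate (u i)) =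
      (toLp 2 : (ι → ℝ) → EuclideanSpace ℝ ι) ∘ fun u i => bmVariate (u i) from rfl,
    ← Measure.map_map (measurable_toLp 2 _) hm,
    Measure.pi_map_pi fun _ => measurable_bmVariate.aemeasurable]
  simp_rw [map_bmVariate]
  exact (map_pi_eq_stdGaussian).symm

/-! ## §2 The Beta primitive from two Marsaglia–Tsang loops -/

/-- **Wood's Beta primitive is the ratio of two independent Marsaglia–Tsang loops** (`d ≥ 7/6`,
shape `a = d + 1/3`). -/
theorem betaMeasure_eq_map_mtLoops {d : ℝ} (hd : 7 / 6 ≤ d) :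
    betaMeasure (d + 1 / 3) (d + 1 / 3) =
      ((loopLaw (mtRound d)).prod (loopLaw (mtRound d))).map fun p : ℝ × ℝ => p.1 / (p.1 + p.2) := by
  rw [loopLaw_mtRound hd, map_ratio_gammaMeasure_prod_self (by linarith)]

/-- **The engine's instance**: the CP(N−1) site heat bath on `ℂ^N` calls `rng_beta_sym(a)` with
`a = (d_ℝ − 1)/2 = N − 1/2` (`d_ℝ = 2N` the real dimension), i.e. two `rng_gamma(N − 1/2)` loops with
Marsaglia–Tsang parameter `d = N − 5/6 ≥ 7/6` — for every `N ≥ 2`. -/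
theorem betaMeasure_cpn_eq_map_mtLoops {N : ℕ} (hN : 2 ≤ N) :
    betaMeasure ((N : ℝ) - 1 / 2) ((N : ℝ) - 1 / 2) =
      ((loopLaw (mtRound ((N : ℝ) - 5 / 6))).prod (loopLaw (mtRound ((N : ℝ) - 5 / 6)))).map
        fun p : ℝ × ℝ => p.1 / (p.1 + p.2) := by
  have hN' : (2 : ℝ) ≤ N := by exact_mod_cast hN
  rw [show (N : ℝ) - 1 / 2 = ((N : ℝ) - 5 / 6) + 1 / 3 by ring]
  exact betaMeasure_eq_map_mtLoops (by linarith)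

/-! ## §3 The site heat bath with Box–Muller Gaussians -/

/-- **THE CP(N−1) SITE HEAT BATH FROM WOOD'S COSINE AND BOX–MULLER PAIRS OF UNIFORMS IS EXACT** for every
mean direction `m`: replacing the standard Gaussian `ξ` of `map_siteHB` by `n + 2` independent Box–Muller
variates of uniforms gives EXACTLY the normalised von Mises–Fisher law `(vmfAt κ m univ)⁻¹ • vmfAt κ m`. -/
theorem map_siteHB_boxMuller {n : ℕ} {κ : ℝ} (hκ : 0 ≤ κ) (hn : 1 ≤ n)
    (m : sphere (0 : EuclideanSpace ℝ (Fin (n + 2))) 1) :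
    ((loopLaw (woodRound κ (n + 1))).prod
        ((Measure.pi fun _ : Fin (n + 2) => unitLaw.prod unitLaw).map
          fun u => toLp 2 fun i => bmVariate (u i))).map
        (fun p : ℝ × EuclideanSpace ℝ (Fin (n + 2)) =>
          siteHB n (m : EuclideanSpace ℝ (Fin (n + 2))) p.1 p.2) =
      ((vmfAt n κ m) univ)⁻¹ • vmfAt n κ m := by
  rw [← stdGaussian_eq_map_boxMuller_pi]
  exact map_siteHB hκ hn m

end Summit.Ventures.LatticeQCDFlow.Exactness
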